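import Mathlib
import Summits.NavierStokesRegularity.NavierStokesRegularity.Theorems.FilamentSkeletonRssDefectColumnGateAzimuthalBlockAxial

/-!
# Route `FilamentSkeletonRss` · cruxes `TransverseReduction1AL` (stmt-NavierStokesRegularity-23297) / `TransverseReduction1AR` (stmt-23611) ·
# registered stub S2a-loc `WaistColumnGateLoc1A` — azimuthal blocks `|m| ≥ 3` with axial dependence, SUP-WEIGHT FORM

Helper file (theorems only, def-free; `--supports stmt-NavierStokesRegularity-23297 --as helper`; hand leafhand-ns-filamentskeletonrs-13 g0).
The square root of `azimuthalBlock_apriori_sq_axial` (`Theorems/…AzimuthalBlockAxial.lean`, p827742): `(1+u)²|a(τ,u)|, (1+u)²|b(τ,u)| ≤ C·M`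
with `C = 2·16(2+13/γ+γ/13)²/γ`, for τ-dependent modes with the axial terms `κ'τ∂_τ − ∂_τ²` in the block equations — the form the θ-synthesis
of the localised sectional gate consumes (same shape as `azimuthalBlock_apriori`, constant doubled).  Kept in its own file by the 400-line rule.
HONEST FRAMING: an a-priori bound for ONE family of blocks of ONE linear MODEL operator of a hypothetical filament-type blow-up route (MODEL rung,
negative side); `WaistColumnGateLoc1A`, `TransverseReduction1AL/1AR` are neither proved nor refuted; nothing here bears on Navier–Stokes regularity.
-/

set_option linter.dupNamespace false

noncomputable section

namespace Summit.NavierStokesRegularity.NavierStokesRegularity.Theorems.DefectColumnGate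

open scoped Topology
open Set Filter

/-- **Azimuthal blocks `|m| ≥ 3` with axial dependence — sup-weight form.**  Same hypotheses as `azimuthalBlock_apriori_sq_axial`; conclusion
`(1+u)²|a(τ,u)| ≤ C·M` and `(1+u)²|b(τ,u)| ≤ C·M` with `C = 2·16(2+13/γ+γ/13)²/γ` (γ only: not `U`, `V`, `m`, `κ'`, nor any axial scale). -/
theorem azimuthalBlock_apriori_axial {γ m U M κ' : ℝ} {a b a₁ b₁ aτ bτ aττ bττ F₁ F₂ V : ℝ → ℝ → ℝ}
    (hγ : 0 < γ) (hm : 9 ≤ m ^ 2) (hκ' : 0 ≤ κ')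
    (hca : ContinuousOn (fun q : ℝ × ℝ => a q.1 q.2) (univ ×ˢ Icc 0 U))
    (hcb : ContinuousOn (fun q : ℝ × ℝ => b q.1 q.2) (univ ×ˢ Icc 0 U))
    (hbdd : ∃ B : ℝ, ∀ τ, ∀ u ∈ Icc 0 U, |a τ u| ≤ B ∧ |b τ u| ≤ B)
    (ha0 : ∀ τ, a τ 0 = 0) (hb0 : ∀ τ, b τ 0 = 0)
    (hdera : ∀ τ u, 0 < u → HasDerivAt (a τ) (a₁ τ u) u) (hderb : ∀ τ u, 0 < u → HasDerivAt (b τ) (b₁ τ u) u)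
    (hdaτ : ∀ u ∈ Ioo 0 U, ∀ τ, HasDerivAt (fun σ => a σ u) (aτ τ u) τ)
    (hdaττ : ∀ u ∈ Ioo 0 U, ∀ τ, HasDerivAt (fun σ => aτ σ u) (aττ τ u) τ)
    (hdbτ : ∀ u ∈ Ioo 0 U, ∀ τ, HasDerivAt (fun σ => b σ u) (bτ τ u) τ)
    (hdbττ : ∀ u ∈ Ioo 0 U, ∀ τ, HasDerivAt (fun σ => bτ σ u) (bττ τ u) τ)
    (hΦa : ∀ τ u, 0 < u → HasDerivAt (fun s => 4 * s * a₁ τ s + γ * s * a τ s)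
      (m ^ 2 / u * a τ u - V τ u * b τ u - F₁ τ u + (κ' * τ * aτ τ u - aττ τ u)) u)
    (hΦb : ∀ τ u, 0 < u → HasDerivAt (fun s => 4 * s * b₁ τ s + γ * s * b τ s)
      (m ^ 2 / u * b τ u + V τ u * a τ u - F₂ τ u + (κ' * τ * bτ τ u - bττ τ u)) u)
    (hF₁ : ∀ τ u, 0 < u → (1 + u) ^ 2 * |F₁ τ u| ≤ M) (hF₂ : ∀ τ u, 0 < u → (1 + u) ^ 2 * |F₂ τ u| ≤ M)
    (hsuppa : ∀ τ u, U ≤ u → a τ u = 0) (hsuppb : ∀ τ u, U ≤ u → b τ u = 0) :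
    ∀ τ u, 0 ≤ u → (1 + u) ^ 2 * |a τ u| ≤ 2 * (16 * (2 + 13 / γ + γ / 13) ^ 2 / γ) * M ∧
      (1 + u) ^ 2 * |b τ u| ≤ 2 * (16 * (2 + 13 / γ + γ / 13) ^ 2 / γ) * M := by
  intro τ u hu
  have hM : 0 ≤ M := le_trans (by positivity) (hF₁ 0 1 one_pos)
  have hsq := azimuthalBlock_apriori_sq_axial hγ hm hκ' hca hcb hbdd ha0 hb0 hdera hderb hdaτ hdaττ hdbτ hdbττ hΦa hΦb hF₁ hF₂
    hsuppa hsuppb τ u hu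
  set C : ℝ := 16 * (2 + 13 / γ + γ / 13) ^ 2 / γ with hCdef
  have hC : 0 ≤ C := by positivity
  have hCM : 0 ≤ 2 * C * M := by positivity
  have h4 : (1 + u) ^ 4 = ((1 + u) ^ 2) ^ 2 := by ring
  constructor
  · have h1 : ((1 + u) ^ 2 * |a τ u|) ^ 2 ≤ (2 * C * M) ^ 2 := by
      have e : ((1 + u) ^ 2 * |a τ u|) ^ 2 = (1 + u) ^ 4 * a τ u ^ 2 := by rw [mul_pow, sq_abs, h4]
      rw [e]
      have h0 : 0 ≤ (1 + u) ^ 4 * b τ u ^ 2 := by positivity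
      calc (1 + u) ^ 4 * a τ u ^ 2 ≤ (1 + u) ^ 4 * (a τ u ^ 2 + b τ u ^ 2) := by rw [mul_add]; linarith
        _ ≤ 4 * C ^ 2 * M ^ 2 := hsq
        _ = (2 * C * M) ^ 2 := by ring
    exact (abs_le_of_sq_le_sq' h1 hCM).2
  · have h1 : ((1 + u) ^ 2 * |b τ u|) ^ 2 ≤ (2 * C * M) ^ 2 := by
      have e : ((1 + u) ^ 2 * |b τ u|) ^ 2 = (1 + u) ^ 4 * b τ u ^ 2 := by rw [mul_pow, sq_abs, h4]
      rw [e]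
      have h0 : 0 ≤ (1 + u) ^ 4 * a τ u ^ 2 := by positivity
      calc (1 + u) ^ 4 * b τ u ^ 2 ≤ (1 + u) ^ 4 * (a τ u ^ 2 + b τ u ^ 2) := by rw [mul_add]; linarith
        _ ≤ 4 * C ^ 2 * M ^ 2 := hsq
        _ = (2 * C * M) ^ 2 := by ring
    exact (abs_le_of_sq_le_sq' h1 hCM).2

end Summit.NavierStokesRegularity.NavierStokesRegularity.Theorems.DefectColumnGate

end
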